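import Summits.BirchSwinnertonDyer.Rank1Residual.X11b.Three.UnramifiedMinimalDescent
import HarnessLib

/-!
# X11b at `p = 3` (team N8/O2), JET3-KUMMER: ANTI-VACUITY of the S15 layer data R1–R6 — the
# trivial layer `ℚ_p / ℚ_p` satisfies every residual binder, and the providers apply to it

HONEST FRAMING (cell `b2b-bsdres`, run/shared/lean/b2b/bsd-rank1-residual/, verbatim in every
file): the goal of the cell is to DELETE the COMBINATION-SHAPED residual classes of the
Birch–Swinnerton-Dyer formula for ALL analytic-rank `≤ 1` elliptic curves over `ℚ` — "full BSD
formula for every rank `≤ 1` curve in class `C`" assembled STRICTLY from published theorems — so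
that the rank-`≤ 1` remainder becomes exactly the CONSTRUCTION-SHAPED classes, which are TYPED
(missing-input `Prop`s), NOT attempted. This is not "finishing BSD". Team N8/O2 = `x11b3`, seat
`b2b-bsdres-x11b3-p4` (provider of record at additive places; owner of `S15-INTERFACE.md`).
THEOREMS ONLY: no definition, no named fact, no `sorry`; nothing is booked; `JET@p|N` is NOT
discharged. HYGIENE ONLY: this file proves nothing new about elliptic curves.

## What

The S15 providers (parts 1–19) are stated for an abstract layer `L ⊇ F` with valuation rings
`R₀ → R` and the residual binders of `S15-INTERFACE.md` §4: R1 `hR` (every `F`-automorphism of `L`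
preserves `R`), R2 `[IsAdicComplete 𝔪 R]`, R3 `[Finite k]` + `hcard : Nat.card k = qⁿ`, R4 `φ`,
`hφ : Aut(L/F) = ⟨φ⟩`, `hn : φⁿ = 1`, `hfrob` (`φ` lifts `x ↦ x^q`), R5 `hϖ`/`hπ` (a uniformiser of
`R` from `F`), R6 `[IsGalois F L]`, plus `[IsLocalHom (algebraMap R₀ R)]`. A statement with
unsatisfiable hypotheses would be content-free; this file records that the binders are JOINTLY
SATISFIABLE by exhibiting the trivial layer `L = F = ℚ_p`, `R = R₀ = ℤ_p`, `φ = 1`, `n = 1`,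
`q = p`, `ϖ = π = p` (every instance found by Mathlib), and that the headline providers then
elaborate on it:

* `trivialLayer_hR`, `trivialLayer_hφ`, `trivialLayer_hfrob`, `trivialLayer_hcard`,
  `trivialLayer_hπ` — R1, R4, R3, R5 for `ℚ_p / ℚ_p` (R2, R6, `IsLocalHom` are instances);
* **`trivialLayer_binders`** — the conjunction of all of R1–R6 (+ `IsLocalHom`, `Irreducible p`)
  for the trivial layer: the S15 residual binder list is JOINTLY SATISFIABLE;
* two `example`s (no declarations): part 19's `isMinimal_baseChange_padic_of_frobenius` and part
  15's `hα_padic_of_not_hasGoodReductionAtPrime_of_adicComplete` ELABORATE on the trivial layer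
  with every binder discharged (the first concludes p8's `isMinimal_baseChange_padic_self`, hence
  is not re-declared).

References (locators only; no new fact): [cite: SilvermanAEC2009, VII.§5 (PDF p. 175)].

## Design

No definitions; `noncomputable section`; `open scoped Classical`. Axioms: `propext`,
`Classical.choice`, `Quot.sound`.
-/

noncomputable section

open scoped Classical

namespace Summit.BirchSwinnertonDyer.Rank1Residual.X11b.Three.JetchevKummer

open WeierstrassCurve

variable (p : ℕ) [Fact p.Prime]

/-- R1 for the trivial layer: the only `ℚ_p`-automorphism of `ℚ_p` is the identity. [folklore] -/
theorem trivialLayer_hR : ∀ (τ : ℚ_[p] ≃ₐ[ℚ_[p]] ℚ_[p]) (x : ℚ_[p]),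
    x ∈ Set.range (algebraMap ℤ_[p] ℚ_[p]) → τ x ∈ Set.range (algebraMap ℤ_[p] ℚ_[p]) := by
  intro τ x hx
  rw [Subsingleton.elim τ AlgEquiv.refl]
  exact hx

/-- R4 (`hφ`) for the trivial layer: `Aut(ℚ_p/ℚ_p) = ⟨1⟩`. [folklore] -/
theorem trivialLayer_hφ : ∀ σ : ℚ_[p] ≃ₐ[ℚ_[p]] ℚ_[p],
    σ ∈ Subgroup.zpowers (AlgEquiv.refl : ℚ_[p] ≃ₐ[ℚ_[p]] ℚ_[p]) := by
  intro σ
  rw [Subsingleton.elim σ AlgEquiv.refl]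
  exact Subgroup.mem_zpowers _

/-- R4 (`hn`) for the trivial layer: `φ¹ = 1`. [folklore] -/
theorem trivialLayer_hn : (AlgEquiv.refl : ℚ_[p] ≃ₐ[ℚ_[p]] ℚ_[p]) ^ 1 = 1 := by
  rw [pow_one]; rfl

/-- R3 (`hcard`) for the trivial layer: `#(ℤ_p/p) = p¹`. [folklore] -/
theorem trivialLayer_hcard : Nat.card (IsLocalRing.ResidueField ℤ_[p]) = p ^ 1 := by
  rw [pow_one, Nat.card_congr (PadicInt.residueField (p := p)).toEquiv, Nat.card_zmod]

/-- R4 (`hfrob`) for the trivial layer: the identity lifts `x ↦ x^p` on `𝔽_p` (Fermat).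
[folklore] -/
theorem trivialLayer_hfrob : ∀ a : ℤ_[p], ∃ a' : ℤ_[p],
    algebraMap ℤ_[p] ℚ_[p] a' = (AlgEquiv.refl : ℚ_[p] ≃ₐ[ℚ_[p]] ℚ_[p]) (algebraMap ℤ_[p] ℚ_[p] a) ∧
      IsLocalRing.residue ℤ_[p] a' = IsLocalRing.residue ℤ_[p] a ^ p := by
  intro a
  refine ⟨a, rfl, ?_⟩
  apply (PadicInt.residueField (p := p)).injective
  rw [map_pow, ZMod.pow_card]

/-- R5 (`hπ`) for the trivial layer: the uniformiser `p` of `ℤ_p` comes from `ℚ_p`. [folklore] -/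
theorem trivialLayer_hπ :
    algebraMap ℚ_[p] ℚ_[p] (p : ℚ_[p]) = algebraMap ℤ_[p] ℚ_[p] (p : ℤ_[p]) := by
  simp

/-- **ANTI-VACUITY of the S15 layer data: the residual binders R1–R6 are jointly satisfiable**
(by the trivial layer `ℚ_p / ℚ_p`, `R = R₀ = ℤ_p`, `φ = 1`, `n = 1`, `q = p`, `ϖ = π = p`; R2
`IsAdicComplete`, R6 `IsGalois`, `IsLocalHom`, `Finite k` are Mathlib instances and are recorded
here as conjuncts found by `inferInstance`). [folklore] -/
theorem trivialLayer_binders :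
    (∀ (τ : ℚ_[p] ≃ₐ[ℚ_[p]] ℚ_[p]) (x : ℚ_[p]), x ∈ Set.range (algebraMap ℤ_[p] ℚ_[p]) →
        τ x ∈ Set.range (algebraMap ℤ_[p] ℚ_[p])) ∧
      IsAdicComplete (IsLocalRing.maximalIdeal ℤ_[p]) ℤ_[p] ∧
      Finite (IsLocalRing.ResidueField ℤ_[p]) ∧ Nat.card (IsLocalRing.ResidueField ℤ_[p]) = p ^ 1 ∧
      (∀ σ : ℚ_[p] ≃ₐ[ℚ_[p]] ℚ_[p], σ ∈ Subgroup.zpowers (AlgEquiv.refl : ℚ_[p] ≃ₐ[ℚ_[p]] ℚ_[p])) ∧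
      (AlgEquiv.refl : ℚ_[p] ≃ₐ[ℚ_[p]] ℚ_[p]) ^ 1 = 1 ∧
      (∀ a : ℤ_[p], ∃ a' : ℤ_[p], algebraMap ℤ_[p] ℚ_[p] a' =
          (AlgEquiv.refl : ℚ_[p] ≃ₐ[ℚ_[p]] ℚ_[p]) (algebraMap ℤ_[p] ℚ_[p] a) ∧
        IsLocalRing.residue ℤ_[p] a' = IsLocalRing.residue ℤ_[p] a ^ p) ∧
      Irreducible (p : ℤ_[p]) ∧
      algebraMap ℚ_[p] ℚ_[p] (p : ℚ_[p]) = algebraMap ℤ_[p] ℚ_[p] (p : ℤ_[p]) ∧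
      IsGalois ℚ_[p] ℚ_[p] ∧ IsLocalHom (algebraMap ℤ_[p] ℤ_[p]) :=
  ⟨trivialLayer_hR p, inferInstance, inferInstance, trivialLayer_hcard p, trivialLayer_hφ p,
    trivialLayer_hn p, trivialLayer_hfrob p, PadicInt.irreducible_p, trivialLayer_hπ p, inferInstance,
    inferInstance⟩

variable (W : WeierstrassCurve ℚ) [W.IsGloballyMinimal]

/-- Sanity (`example`, no declaration): part 19's minimality provider
`isMinimal_baseChange_padic_of_frobenius` ELABORATES on the trivial layer with every binder
discharged; its conclusion there is p8's `isMinimal_baseChange_padic_self`. [folklore] -/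
example : ((W.baseChange ℚ_[p]).baseChange ℚ_[p]).IsMinimal ℤ_[p] :=
  isMinimal_baseChange_padic_of_frobenius W p ℚ_[p] ℤ_[p] (trivialLayer_hR p) AlgEquiv.refl
    (trivialLayer_hφ p) (trivialLayer_hn p) (trivialLayer_hcard p) (trivialLayer_hfrob p)
    PadicInt.irreducible_p (trivialLayer_hπ p)

/-- Sanity (`example`, no declaration): part 15's (α) provider
`hα_padic_of_not_hasGoodReductionAtPrime_of_adicComplete` ELABORATES on the trivial layer for
`E/ℚ` with bad reduction at `p`, the `R`-model being Mathlib's integral model (the base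
minimality instance is taken as a binder here; it is p8's `isMinimal_baseChange_padic_self`).
[folklore] -/
example [W.IsElliptic] [((W.baseChange ℚ_[p]).baseChange ℚ_[p]).IsMinimal ℤ_[p]]
    (hg : ¬ W.HasGoodReductionAtPrime p) :
    ∀ Q : ((W.baseChange ℚ_[p]).baseChange ℚ_[p]).toAffine.Point,
      (∀ σ : ℚ_[p] ≃ₐ[ℚ_[p]] ℚ_[p],
          σ • Q - Q ∈ ((W.baseChange ℚ_[p]).baseChange ℚ_[p]).goodReductionSubgroup ℤ_[p]) →
        ∃ Q' : ((W.baseChange ℚ_[p]).baseChange ℚ_[p]).toAffine.Point,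
          (∀ σ : ℚ_[p] ≃ₐ[ℚ_[p]] ℚ_[p], σ • Q' = Q') ∧
            Q - Q' ∈ ((W.baseChange ℚ_[p]).baseChange ℚ_[p]).goodReductionSubgroup ℤ_[p] :=
  hα_padic_of_not_hasGoodReductionAtPrime_of_adicComplete W p ℚ_[p] ℤ_[p] hg
    (((W.baseChange ℚ_[p]).baseChange ℚ_[p]).integralModel ℤ_[p])
    (baseChange_integralModel_eq ℤ_[p] _).symm (trivialLayer_hR p) AlgEquiv.refl (trivialLayer_hφ p)
    (trivialLayer_hn p) (trivialLayer_hcard p) (trivialLayer_hfrob p) PadicInt.irreducible_p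
    (trivialLayer_hπ p)

end Summit.BirchSwinnertonDyer.Rank1Residual.X11b.Three.JetchevKummer

end
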